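import Summits.BirchSwinnertonDyer.BirchSwinnertonDyer.Theorems.UniversalToricDescentThinCombGradingRenormalisation
import Summits.BirchSwinnertonDyer.BirchSwinnertonDyer.Theorems.PrintCf2RubinValueTwoAvatarOnRayDegreeOne
import HarnessLib

/-!
# GRADING RENORMALISATION of ♯♯-frames, II: the FIRST grading `X^a` is free up to `ℤ_pˣ` as well
# (helper on the rational wall `RationalSplitIMCInclusionAtThree`, stmt-BirchSwinnertonDyer-24207, line `ratwall_thin_comb` v10;
# cell `pub/bsd-wall`, LEAD `cruxlead-24207` g36; `--supports stmt-BirchSwinnertonDyer-24207`; nothing is closed; BSD is not proved)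

WHY THIS FILE. Part I (`…ThinComb.GradingRenormalisation`, p770901) showed that the second grading `Y^b` of a ♯♯-frame
(`IsToricTwoVarLFunctionUpTo₂ C X Y …`) can be rescaled by any `u ∈ ℤ_pˣ`, through a grading element `g_u ∈ Γ_K` at the CONJUGATE prime
`𝔭′` (`r_ψ(g_u) = u^b` for every `ψ` of type `(a, −b)` — the conjugate exponent). This file is the mirror statement at the prime `𝔭` INDUCED by
`ι′`: there the unique local embedding `K_𝔭 ≅ ℚ_p ⊆ ℚ̄_p` composed with `ι′` IS the distinguished complex embedding of its place
(`PrintCf2.AvatarOnRay.comp_eq_of_place_eq`), so its exponent in the type `(a, −b)` is `a` and a local Weil element over the unit `u⁻¹` has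
`r_ψ = u^a` on the whole interpolation scope (§2); hence the constants `(C, X, Y)` of a frame may be renormalised to `(C, X·u, Y)` (§3), and together
with Part I to `(C, X·u₁, Y·u₂)` for all `u₁, u₂ ∈ ℤ_pˣ`: the renormalisation group of ♯♯-frames CONTAINS `ℤ_pˣ × ℤ_pˣ`. For the line this is the
precise content of «periods are free up to `p`-adic units in EACH grading», used in LEAD-CENSUS-g36 §2 (robustness ladder (N) / (N♭) / v8.2).

* §1 `isToricTwoVarLFunctionUpTo₂_groupLike_mul_fst` — if `r_ψ(g) = ν^a` on the scope, `(group-like of g)·L₂` has constants `(C, X·ν, Y)`.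
* §2 `exists_avatarValueAt_eq_unit_pow_fst` — `∀ u ∈ ℤ_pˣ ∃ g ∈ Γ_K ∀ ψ (type (a,−b), unramified) ∀ avatar r : r(g) = u^a` (local algebraicity at `𝔭`).
* §3 `exists_isToricTwoVarLFunctionUpTo₂_rescale_fst` (`(C,X,Y) ⟹ (C,X·u,Y)`), `exists_isToricTwoVarLFunctionUpTo₂_rescale_both`
  (`(C,X,Y) ⟹ (C,X·u₁,Y·u₂)`).

HONEST SCOPE: statements about the interpolation predicate only; nothing here is evidence that a ♯♯-frame exists at an additive split `3`; BSD is proved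
for no curve; 24207 / 20395 / 20186 / 32493 OPEN.

References: [cite: SerreAbelianLadic1968, Ch. III §2.3, Ch. II §3.1] [cite: SerreLocalFields1979, Ch. XIII §4 Thm. 2] [cite: FrohlichTaylor1990, Ch. III §1 (1.14)(a)]
[cite: CastellaWan2023, §2.4 Thm. 2.11 (arXiv:1607.02019)] [cite: HaoLoeffler2025, Thm. 3.5 (arXiv:2405.12611)] [cite: Weil1956, §1]
-/

set_option linter.dupNamespace false
set_option autoImplicit false

noncomputable section

open scoped MatrixGroups
open Filter Topology Field
open Literature.NumberTheory.EllipticCurves Literature.NumberTheory.IwasawaTheory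
open Literature.NumberTheory.GaloisRepresentations

namespace Summit.BirchSwinnertonDyer.BirchSwinnertonDyer.Theorems.UniversalToricDescentThinComb.GradingRenormalisation

open Summit.BirchSwinnertonDyer.Rank1Residual.X11b.Halves
open Summit.BirchSwinnertonDyer.BirchSwinnertonDyer.Theorems.UniversalToricDescentThinComb.FrameValues
open Summit.BirchSwinnertonDyer.BirchSwinnertonDyer.Theorems.UniversalToricDescentThinComb.LineValue

/-! ### §1. Multiplying by a group-like element with `r_ψ(g) = ν^a` rescales the FIRST grading -/

section GroupLikeFst

variable {p : ℕ} [Fact p.Prime] {K : Type} [Field K] [NumberField K]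
  {κ₁ κ₂ : ZpExtension K p} {γ₁ γ₂ : absoluteGaloisGroup K}

/-- **First-grading version of `isToricTwoVarLFunctionUpTo₂_groupLike_mul`**: if `r_ψ(g) = ν^a` for every interpolation character `ψ` of
type `(a, −b)` and every avatar, then `(1+T₁)^{κ₁ g}(1+T₂)^{κ₂ g} · L₂` is a ♯♯-frame with constants `(C, X·ν, Y)`.
[cite: CastellaWan2023, §2.4 Thm. 2.11 (arXiv:1607.02019)] [cite: HaoLoeffler2025, Thm. 3.5 (arXiv:2405.12611)] -/
theorem isToricTwoVarLFunctionUpTo₂_groupLike_mul_fst {N : ℕ} {ι : PadicAlgCl p ≃+* ℂ}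
    {𝔭 𝔭' : IsDedekindDomain.HeightOneSpectrum (NumberField.RingOfIntegers K)}
    (hpair : ZpExtension.IsTopGeneratorPair κ₁ κ₂ γ₁ γ₂)
    {f : CuspForm (CongruenceSubgroup.Gamma0 N) 2} {ΩK : ℂ} {C X Y : ℂ_[p]} {L₂ : PowerSeries (UnrSeries p)}
    (g : absoluteGaloisGroup K) (ν : ℂ_[p])
    (hg : ∀ (ψ : HeckeCharacter K) (a b : ℕ), 1 ≤ a → 1 ≤ b →
      ψ.HasInfinityType (fun _ ↦ (a : ℤ)) (fun _ ↦ -(b : ℤ)) →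
      (∀ w : IsDedekindDomain.HeightOneSpectrum (NumberField.RingOfIntegers K), ψ.IsUnramifiedAt w) →
      ∀ r : FramedGaloisRep K (PadicAlgCl p) 1, IsPAdicAvatarOf ι ψ r → avatarValueAt r g = ν ^ a)
    (hL : IsToricTwoVarLFunctionUpTo₂ C X Y ι 𝔭 𝔭' κ₁ κ₂ γ₁ γ₂ f ΩK L₂) :
    IsToricTwoVarLFunctionUpTo₂ C (X * ν) Y ι 𝔭 𝔭' κ₁ κ₂ γ₁ γ₂ f ΩK
      ((PowerSeries.map (PowerSeries.C (R := unrIntegers p))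
          ((PowerSeries.binomialSeries ℤ_[p] (Multiplicative.toAdd (κ₁ g))).map (toUnr p)) *
        PowerSeries.C ((PowerSeries.binomialSeries ℤ_[p] (Multiplicative.toAdd (κ₂ g))).map (toUnr p))) * L₂) := by
  intro ψ a b ha hb hinf hunr r hψr hrκ L hLd hLe
  have h1 := hasValueAt₂_groupLike hpair hrκ g
  rw [hg ψ a b ha hb hinf hunr r hψr] at h1
  have h2 := hL ψ a b ha hb hinf hunr r hψr hrκ L hLd hLe
  have hx : ‖avatarValueAt r γ₁ - 1‖ < 1 := norm_avatarValueAt_sub_one_lt_of_factorsThroughPair hrκ γ₁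
  have hy : ‖avatarValueAt r γ₂ - 1‖ < 1 := norm_avatarValueAt_sub_one_lt_of_factorsThroughPair hrκ γ₂
  have h := hasValueAt₂_mul hx hy h1 h2
  convert h using 1
  rw [mul_pow]
  ring

end GroupLikeFst

/-! ### §2. The grading element at the INDUCED prime: `r_ψ(g) = u^a` for every `ψ` of type `(a, −b)` -/

section InducedPrime

open NumberField IsDedekindDomain
open Literature.NumberTheory.NumberFields
open Summit.BirchSwinnertonDyer.Rank1Residual.X2.PNewDisplay

variable {p : ℕ} [Fact p.Prime] {K : Type} [Field K] [NumberField K]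

/-- **THE GRADING ELEMENT AT THE INDUCED PRIME.** Let `K` be imaginary quadratic, `𝔭 ∋ p` of degree one, `ι′ : ℚ̄_p ≃ ℂ` inducing `𝔭`
(`BranchInducesPrime p ι′ 𝔭`), and `u ∈ ℤ_pˣ`. There is a FIXED `g ∈ Γ_K` — the restriction of a Weil element of `K_𝔭 ≅ ℚ_p` whose Artin
image is the unit `u⁻¹` — such that for EVERY Hecke character `ψ` of infinity type `(a, −b)` unramified everywhere and EVERY `p`-adic avatar `r`:
**`r(g) = u^a`**. PROOF: local–global compatibility above `p` (`PNewDisplay.avatar_entry_eq_of_isPAdicAvatarOf`):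
`r(res w) = ι′⁻¹(ψ(⟨a w⟩_𝔭)) · ∏_e e(a w)^{−n_e}`; `ψ` is unramified at `𝔭` and `a w = u⁻¹` is a unit, so the first factor is `1`; the unique
continuous `e : K_𝔭 → ℚ̄_p` composed with `ι′` IS the distinguished embedding of its infinite place (`AvatarOnRay.comp_eq_of_place_eq`, because `ι′`
induces `𝔭`), so its exponent is `a` (`embExponent_embedding`, `K` totally complex), giving `(u⁻¹)^{−a} = u^a`.
[cite: SerreAbelianLadic1968, Ch. III §2.3, Ch. II §3.1] [cite: SerreLocalFields1979, Ch. XIII §4 Thm. 2] [cite: FrohlichTaylor1990, Ch. III §1 (1.14)(a)] -/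
theorem exists_avatarValueAt_eq_unit_pow_fst (ι : PadicAlgCl p ≃+* ℂ) (hK : IsImaginaryQuadratic K)
    {𝔭 : HeightOneSpectrum (𝓞 K)} (h𝔭 : ((p : ℕ) : 𝓞 K) ∈ 𝔭.asIdeal)
    (he : 𝔭.asIdeal.ramificationIdx (𝓞 ℚ) = 1) (hf : 𝔭.asIdeal.inertiaDeg (𝓞 ℚ) = 1)
    (hι : Summit.BirchSwinnertonDyer.BirchSwinnertonDyer.Theorems.SchneiderFree.BranchInducesPrime p ι 𝔭)
    (u : ℤ_[p]ˣ) :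
    ∃ g : absoluteGaloisGroup K, ∀ (ψ : HeckeCharacter K) (a b : ℕ) (r : FramedGaloisRep K (PadicAlgCl p) 1),
      ψ.HasInfinityType (fun _ ↦ (a : ℤ)) (fun _ ↦ -(b : ℤ)) →
      (∀ w : HeightOneSpectrum (𝓞 K), ψ.IsUnramifiedAt w) → IsPAdicAvatarOf ι ψ r →
        avatarValueAt r g = (algebraMap ℚ_[p] ℂ_[p] ((u : ℤ_[p]) : ℚ_[p])) ^ a := by
  classical
  haveI : NumberField.IsTotallyComplex K := hK.2
  haveI := liesOver_ratPlace_of_natCast_mem K 𝔭 h𝔭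
  -- the unit `z ↔ u⁻¹` of `K_𝔭`
  set w𝒪 : (𝔭.adicCompletionIntegers K)ˣ :=
    Units.map (padicIntEquivOfDegreeOne K p 𝔭 he hf).symm.toRingHom.toMonoidHom u⁻¹ with hw𝒪
  have hz1 : Valued.v (((w𝒪 : 𝔭.adicCompletionIntegers K) : 𝔭.adicCompletion K)) = 1 :=
    Literature.NumberTheory.GaloisRepresentations.valued_coe_units_adicCompletionIntegers w𝒪
  have hz0 : (((w𝒪 : 𝔭.adicCompletionIntegers K) : 𝔭.adicCompletion K)) ≠ 0 := by
    intro h; rw [h, map_zero] at hz1; exact zero_ne_one hz1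
  set z : (𝔭.adicCompletion K)ˣ := Units.mk0 _ hz0 with hz
  have hzu : padicEquivOfDegreeOne K p 𝔭 he hf ((z : (𝔭.adicCompletion K)ˣ) : 𝔭.adicCompletion K) =
      (((u⁻¹ : ℤ_[p]ˣ) : ℤ_[p]) : ℚ_[p]) := by
    rw [hz, Units.val_mk0, ← coe_padicIntEquivOfDegreeOne_apply, hw𝒪]
    simp
  -- the local Artin map and a Weil element over `z`
  obtain ⟨art, ha⟩ := exists_isLocalArtinMap_holds (𝔭.adicCompletion K)
  obtain ⟨w₀, hw₀⟩ := ha.isOpenQuotientMap_artin.surjective z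
  -- the unique local embedding, explicitly; composed with `ι` it is the distinguished embedding of its place
  set e₀ : 𝔭.adicCompletion K →+* PadicAlgCl p :=
    (algebraMap ℚ_[p] (PadicAlgCl p)).comp (padicEquivOfDegreeOne K p 𝔭 he hf).toRingHom with he₀
  have he₀c : Continuous e₀ :=
    (continuous_algebraMap ℚ_[p] (PadicAlgCl p)).comp (continuous_padicEquivOfDegreeOne K p 𝔭 he hf)
  set wInf : InfinitePlace K := Classical.arbitrary (InfinitePlace K)
  refine ⟨absGaloisRestrict K (𝔭.adicCompletion K) (WeilGroup.toAbsGalois (𝔭.adicCompletion K) w₀),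
    fun ψ a b r hinf hunr hav ↦ ?_⟩
  have key := avatar_entry_eq_of_isPAdicAvatarOf hinf ι (T := ∅) (fun w _ ↦ hunr w) hav h𝔭 art ha w₀
  rw [hw₀, univ_localEmbedding_eq_singleton h𝔭 he hf ⟨e₀, he₀c⟩, Finset.prod_singleton] at key
  have hψ1 : ψ (localUnits 𝔭 z) = 1 := (hunr 𝔭).map_localUnits_eq_one z (by rw [hz, Units.val_mk0]; exact hz1)
  have hexp : HeckeCharacter.embExponent (fun _ : InfinitePlace K ↦ (a : ℤ)) (fun _ ↦ -(b : ℤ))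
      ((ι : PadicAlgCl p →+* ℂ).comp
        ((⟨e₀, he₀c⟩ : {e : 𝔭.adicCompletion K →+* PadicAlgCl p // Continuous e}).1.comp
          (algebraMap K (𝔭.adicCompletion K)))) = (a : ℤ) := by
    have h1 := PrintCf2.AvatarOnRay.embExponent_eq_of_place ι (fun _ : InfinitePlace K ↦ (a : ℤ)) (fun _ ↦ -(b : ℤ))
      he hf wInf.embedding (hι wInf)
    have h2 := PrintCf2.AvatarOnRay.embExponent_embedding (fun _ : InfinitePlace K ↦ (a : ℤ)) (fun _ ↦ -(b : ℤ)) wInf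
    exact h1.trans h2
  have he₀z : e₀ ((z : (𝔭.adicCompletion K)ˣ) : 𝔭.adicCompletion K) =
      algebraMap ℚ_[p] (PadicAlgCl p) (((u⁻¹ : ℤ_[p]ˣ) : ℤ_[p]) : ℚ_[p]) := by
    rw [he₀, RingHom.comp_apply]
    exact congrArg _ hzu
  have hinvQ : (((u⁻¹ : ℤ_[p]ˣ) : ℤ_[p]) : ℚ_[p]) = (((u : ℤ_[p]) : ℚ_[p]))⁻¹ :=
    eq_inv_of_mul_eq_one_left (by rw [← PadicInt.coe_mul, Units.inv_mul, PadicInt.coe_one])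
  rw [hψ1, Units.val_one, map_one, one_mul, hexp] at key
  rw [avatarValueAt_eq_entry, key]
  change algebraMap (PadicAlgCl p) ℂ_[p] ((e₀ ((z : (𝔭.adicCompletion K)ˣ) : 𝔭.adicCompletion K)) ^ (-(a : ℤ))) = _
  rw [map_zpow₀, he₀z, ← IsScalarTower.algebraMap_apply, hinvQ, map_inv₀, zpow_neg, zpow_natCast, inv_pow, inv_inv]

end InducedPrime

/-! ### §3. Rescaling the first grading, and both gradings, by units of `ℤ_p` -/

section RescaleFst

open NumberField IsDedekindDomain

variable {p : ℕ} [Fact p.Prime] {K : Type} [Field K] [NumberField K]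
  {κ₁ κ₂ : ZpExtension K p} {γ₁ γ₂ : absoluteGaloisGroup K}

/-- **RESCALING THE FIRST GRADING BY A UNIT OF `ℤ_p`**: in the setting of the line's stubs (`K` imaginary quadratic, `𝔭 ∋ p` of degree one,
`ι′` inducing `𝔭`, any generator pair), a ♯♯-frame with constants `(C, X, Y)` yields one with `(C, X·u, Y)` for every `u ∈ ℤ_pˣ`.
[cite: SerreAbelianLadic1968, Ch. III §2.3] [cite: CastellaWan2023, §2.4 Thm. 2.11 (arXiv:1607.02019)] -/
theorem exists_isToricTwoVarLFunctionUpTo₂_rescale_fst {N : ℕ} (ι : PadicAlgCl p ≃+* ℂ) (hK : IsImaginaryQuadratic K)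
    {𝔭 𝔭' : HeightOneSpectrum (𝓞 K)} (h𝔭 : ((p : ℕ) : 𝓞 K) ∈ 𝔭.asIdeal)
    (he : 𝔭.asIdeal.ramificationIdx (𝓞 ℚ) = 1) (hf : 𝔭.asIdeal.inertiaDeg (𝓞 ℚ) = 1)
    (hι : Summit.BirchSwinnertonDyer.BirchSwinnertonDyer.Theorems.SchneiderFree.BranchInducesPrime p ι 𝔭)
    (hpair : ZpExtension.IsTopGeneratorPair κ₁ κ₂ γ₁ γ₂)
    {f : CuspForm (CongruenceSubgroup.Gamma0 N) 2} {ΩK : ℂ} {C X Y : ℂ_[p]} {L₂ : PowerSeries (UnrSeries p)}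
    (hL : IsToricTwoVarLFunctionUpTo₂ C X Y ι 𝔭 𝔭' κ₁ κ₂ γ₁ γ₂ f ΩK L₂) (u : ℤ_[p]ˣ) :
    ∃ L₂' : PowerSeries (UnrSeries p),
      IsToricTwoVarLFunctionUpTo₂ C (X * algebraMap ℚ_[p] ℂ_[p] ((u : ℤ_[p]) : ℚ_[p])) Y ι 𝔭 𝔭' κ₁ κ₂ γ₁ γ₂ f ΩK L₂' := by
  obtain ⟨g, hg⟩ := exists_avatarValueAt_eq_unit_pow_fst ι hK h𝔭 he hf hι u
  exact ⟨_, isToricTwoVarLFunctionUpTo₂_groupLike_mul_fst hpair g _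
    (fun ψ a b _ _ hinf hunr r hr ↦ hg ψ a b r hinf hunr hr) hL⟩

/-- **BOTH GRADINGS ARE FREE UP TO `ℤ_pˣ × ℤ_pˣ`**: with `p = 𝔭𝔭′` split in the imaginary quadratic `K`, `𝔭` of degree one induced by `ι′`,
a ♯♯-frame with constants `(C, X, Y)` yields one with `(C, X·u₁, Y·u₂)` for all `u₁, u₂ ∈ ℤ_pˣ` (Part I at `𝔭′` for `Y`, §3 at `𝔭` for `X`).
[cite: SerreAbelianLadic1968, Ch. III §2.3] [cite: CastellaWan2023, §2.4 Thm. 2.11 (arXiv:1607.02019)] -/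
theorem exists_isToricTwoVarLFunctionUpTo₂_rescale_both {N : ℕ} (ι : PadicAlgCl p ≃+* ℂ) (hK : IsImaginaryQuadratic K)
    {𝔭 𝔭' : HeightOneSpectrum (𝓞 K)} (h𝔭 : ((p : ℕ) : 𝓞 K) ∈ 𝔭.asIdeal)
    (he : 𝔭.asIdeal.ramificationIdx (𝓞 ℚ) = 1) (hf : 𝔭.asIdeal.inertiaDeg (𝓞 ℚ) = 1)
    (h𝔭' : ((p : ℕ) : 𝓞 K) ∈ 𝔭'.asIdeal) (hne : 𝔭' ≠ 𝔭)
    (hι : Summit.BirchSwinnertonDyer.BirchSwinnertonDyer.Theorems.SchneiderFree.BranchInducesPrime p ι 𝔭)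
    (hpair : ZpExtension.IsTopGeneratorPair κ₁ κ₂ γ₁ γ₂)
    {f : CuspForm (CongruenceSubgroup.Gamma0 N) 2} {ΩK : ℂ} {C X Y : ℂ_[p]} {L₂ : PowerSeries (UnrSeries p)}
    (hL : IsToricTwoVarLFunctionUpTo₂ C X Y ι 𝔭 𝔭' κ₁ κ₂ γ₁ γ₂ f ΩK L₂) (u₁ u₂ : ℤ_[p]ˣ) :
    ∃ L₂' : PowerSeries (UnrSeries p),
      IsToricTwoVarLFunctionUpTo₂ C (X * algebraMap ℚ_[p] ℂ_[p] ((u₁ : ℤ_[p]) : ℚ_[p]))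
        (Y * algebraMap ℚ_[p] ℂ_[p] ((u₂ : ℤ_[p]) : ℚ_[p])) ι 𝔭 𝔭' κ₁ κ₂ γ₁ γ₂ f ΩK L₂' := by
  obtain ⟨L₁, hL₁⟩ := exists_isToricTwoVarLFunctionUpTo₂_rescale_fst ι hK h𝔭 he hf hι hpair hL u₁
  exact exists_isToricTwoVarLFunctionUpTo₂_rescale_snd ι hK h𝔭 h𝔭' hne hι hpair hL₁ u₂

end RescaleFst

end Summit.BirchSwinnertonDyer.BirchSwinnertonDyer.Theorems.UniversalToricDescentThinComb.GradingRenormalisation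

end
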